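import Mathlib
import Summits.QuantumFields.YangMills.Theorems.CovariantCurrentDoorCurrentCommutatorCeilingStubCauchySchwarzCommutator
import Summits.QuantumFields.YangMills.Theorems.TransportFieldFlowInvariance
import HarnessLib

/-!
# Item `CovariantCurrentDoor.CurrentStatePhysical` ⟨stmt-QuantumFields-23381⟩ — the ORTHOGONALITY clause `⟨XΩ, Ω⟩ = 0`

Support file (the item is `IsPhys (XΩ) ∧ ⟨XΩ, Ω⟩ = 0`; this file proves the second conjunct, `l2_current_vacuum_eq_zero`, with the item's
`let`-chain verbatim).  Route: for each base site `x` the direction field `U ↦ b_{x+ê₀}(U)` (colour vector of the smoothed field `B`) is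
BLIND to the link `(x,0)` (`B` is built from direction-`1` Polyakov loops and direction-`1,2` links only: `smoothedField_update_dir0`) and
continuous (`continuous_smoothedField`, stub file of ⟨23379⟩); by the regularity kit the vacuum is differentiable along the right flow
`t ↦ U[(x,0) ↦ U_{(x,0)} expPauli(t b)]` with a continuous (hence bounded) derivative, and the flow property (blindness + `expPauli_smul_add`)
makes `Ω` Lipschitz along it; so the tree's right-Haar-invariance identity `TransportField.integral_deriv_flow_eq_zero` (✓p738247) applies to
`G = Ω²`: `0 = ∫ ∂_t|₀ Ω²(U_t) dU = 2 ∫ Ω ∂_xΩ dU`, and summing over `x` gives `⟨XΩ, Ω⟩ = 0`.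
HONEST FRAMING: the `IsPhys (XΩ)` clause (gauge covariance of `B`) is NOT in this file; the crux, K2a and the YM mass gap are NOT proved.
No `sorry`, no new axiom, no new definition.  References: [cite: ReedSimonIV1978, Thm. XIII.43]; [cite: Balaban1985UV3, p. 260].
-/

set_option autoImplicit false

noncomputable section

open MeasureTheory Filter Topology
open scoped BigOperators
open Literature.MathematicalPhysics.QuantumFieldTheory (GaugeConfig Site Edge lineHolonomy)
open Literature.MathematicalPhysics.QuantumLattice (secondCountableTopology_su2)
open Literature.MathematicalPhysics.QuantumFieldTheory.Balaban1983to89.B10Eq18SigmaSU2 (pauli)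
open Literature.MathematicalPhysics.QuantumFieldTheory.Balaban1983to89.B10Eq18SigmaSU2Haar (expPauli expPauli_zero)
open Summit.QuantumFields.YangMills.Theorems.EquipartitionPinsProbe.TangentSteinFiniteBeta (lipschitz_of_flow exists_abs_le_of_continuous)

namespace Summit.QuantumFields.YangMills.Theorems.CovariantCurrentDoor

open Summit.QuantumFields.YangMills.Theorems.FemtoTransferGap
open Summit.QuantumFields.YangMills.Theorems.TransportField

variable {L : ℕ} [NeZero L]

/-! ## §1 Blindness of the smoothed field to direction-`0` links -/

omit [NeZero L] in
/-- A straight line holonomy in direction `k ≠ k'` does not see the link `(x, k')`. [folklore] -/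
theorem lineHolonomy_update_of_ne {k k' : Fin 3} (hk : k ≠ k') (U : GaugeConfig 3 L SU2) (x : Site 3 L) (y : SU2) :
    ∀ (n : ℕ) (s : Site 3 L), lineHolonomy (Function.update U (x, k') y) k n s = lineHolonomy U k n s := by
  intro n
  induction n with
  | zero => intro s; rfl
  | succ n ih =>
    intro s
    have hne : (s, k) ≠ (x, k') := fun h => hk (congrArg Prod.snd h)
    simp only [lineHolonomy, Function.update_of_ne hne, ih]

omit [NeZero L] in
/-- The direction-`1` Polyakov entry does not see direction-`0` links. [folklore] -/
theorem polyakovSite_one_update_dir0 (U : GaugeConfig 3 L SU2) (x s : Site 3 L) (y : SU2) :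
    polyakovSite s (Function.update U (x, (0 : Fin 3)) y) ((0 : Site 3 1), (1 : Fin 3)) = polyakovSite s U ((0 : Site 3 1), (1 : Fin 3)) := by
  show lineHolonomy (Function.update U (x, (0 : Fin 3)) y) 1 L s = lineHolonomy U 1 L s
  exact lineHolonomy_update_of_ne (by decide) U x y L s

omit [NeZero L] in
/-- One covariant smoothing step does not see direction-`0` links. [folklore] -/
theorem smoothStep_update_dir0 (U : GaugeConfig 3 L SU2) (x : Site 3 L) (y : SU2) (m : Site 3 L → Matrix (Fin 2) (Fin 2) ℂ) (s : Site 3 L) :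
    (1 / 5 : ℂ) • (m s + ∑ i ∈ ({1, 2} : Finset (Fin 3)),
        (su2Rep ((Function.update U (x, (0 : Fin 3)) y) (s, i)) * m (s.shift i) * su2Rep ((Function.update U (x, (0 : Fin 3)) y) (s, i))⁻¹ +
          su2Rep ((Function.update U (x, (0 : Fin 3)) y) (s - Pi.single i 1, i))⁻¹ * m (s - Pi.single i 1) *
            su2Rep ((Function.update U (x, (0 : Fin 3)) y) (s - Pi.single i 1, i)))) =
    (1 / 5 : ℂ) • (m s + ∑ i ∈ ({1, 2} : Finset (Fin 3)),
        (su2Rep (U (s, i)) * m (s.shift i) * su2Rep (U (s, i))⁻¹ +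
          su2Rep (U (s - Pi.single i 1, i))⁻¹ * m (s - Pi.single i 1) * su2Rep (U (s - Pi.single i 1, i)))) := by
  have hne : ∀ (i : Fin 3), i ≠ 0 → ∀ s' : Site 3 L, ((s', i) : Edge 3 L) ≠ (x, (0 : Fin 3)) :=
    fun i hi s' h => hi (congrArg Prod.snd h)
  have h12 : ((1 : Fin 3)) ≠ 2 := by decide
  rw [Finset.sum_pair h12, Finset.sum_pair h12,
    Function.update_of_ne (hne 1 (by decide) s), Function.update_of_ne (hne 2 (by decide) s),
    Function.update_of_ne (hne 1 (by decide) _), Function.update_of_ne (hne 2 (by decide) _)]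

omit [NeZero L] in
/-- **The smoothed field `B = T_U^{[n]}M₀(U)` is blind to every direction-`0` link.** [folklore] -/
theorem smoothedField_update_dir0 (n : ℕ) (U : GaugeConfig 3 L SU2) (x : Site 3 L) (y : SU2) :
    (fun m : Site 3 L → Matrix (Fin 2) (Fin 2) ℂ => fun s : Site 3 L =>
        (1 / 5 : ℂ) • (m s + ∑ i ∈ ({1, 2} : Finset (Fin 3)),
          (su2Rep ((Function.update U (x, (0 : Fin 3)) y) (s, i)) * m (s.shift i) * su2Rep ((Function.update U (x, (0 : Fin 3)) y) (s, i))⁻¹ +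
            su2Rep ((Function.update U (x, (0 : Fin 3)) y) (s - Pi.single i 1, i))⁻¹ * m (s - Pi.single i 1) *
              su2Rep ((Function.update U (x, (0 : Fin 3)) y) (s - Pi.single i 1, i)))))^[n]
      (fun s : Site 3 L =>
        ((su2Rep (polyakovSite s (Function.update U (x, (0 : Fin 3)) y) ((0 : Site 3 1), (1 : Fin 3)))).trace.re : ℂ) •
          ((1 / 2 : ℂ) • (su2Rep (polyakovSite s (Function.update U (x, (0 : Fin 3)) y) ((0 : Site 3 1), (1 : Fin 3))) -
            su2Rep (polyakovSite s (Function.update U (x, (0 : Fin 3)) y) ((0 : Site 3 1), (1 : Fin 3)))⁻¹))) =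
    (fun m : Site 3 L → Matrix (Fin 2) (Fin 2) ℂ => fun s : Site 3 L =>
        (1 / 5 : ℂ) • (m s + ∑ i ∈ ({1, 2} : Finset (Fin 3)),
          (su2Rep (U (s, i)) * m (s.shift i) * su2Rep (U (s, i))⁻¹ +
            su2Rep (U (s - Pi.single i 1, i))⁻¹ * m (s - Pi.single i 1) * su2Rep (U (s - Pi.single i 1, i)))))^[n]
      (fun s : Site 3 L =>
        ((su2Rep (polyakovSite s U ((0 : Site 3 1), (1 : Fin 3)))).trace.re : ℂ) •
          ((1 / 2 : ℂ) • (su2Rep (polyakovSite s U ((0 : Site 3 1), (1 : Fin 3))) -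
            su2Rep (polyakovSite s U ((0 : Site 3 1), (1 : Fin 3)))⁻¹))) := by
  simp only [smoothStep_update_dir0, polyakovSite_one_update_dir0]

/-! ## §2 One base site: `∫ Ω ∂_xΩ dU = 0` -/

/-- **`∫ Ω(U) · ∂_t|₀ Ω(U[e ↦ U_e expPauli(t a(U))]) dU = 0`** for a continuous `e`-blind direction field `a` and a physical vacuum `Ω`:
right-Haar invariance of the link `e` (tree `integral_deriv_flow_eq_zero`) applied to `G = Ω²`, which is Lipschitz and differentiable along
the flow by the regularity kit. [cite: ReedSimonIV1978, Thm. XIII.43] -/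
theorem integral_vacuum_mul_deriv_eq_zero (β : ℝ) (e : Edge 3 L) {a : GaugeConfig 3 L SU2 → EuclideanSpace ℝ (Fin 3)}
    (ha : Continuous a) (hblind : ∀ (U : GaugeConfig 3 L SU2) (y : SU2), a (Function.update U e y) = a U)
    {Ω : GaugeConfig 3 L SU2 → ℝ} (hΩ : IsPhys Ω) (heig : transferApply β Ω = topValue su2Rep L β • Ω) :
    ∫ U, Ω U * deriv (fun t : ℝ => Ω (Function.update U e (U e * expPauli (t • a U)))) 0 ∂configMeasure SU2 L = 0 := by
  haveI : SecondCountableTopology SU2 := secondCountableTopology_su2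
  obtain ⟨CΩ, hCΩ⟩ := hΩ.bounded
  have hCΩ0 : 0 ≤ CΩ := (abs_nonneg _).trans (hCΩ (fun _ => 1))
  -- the derivative field and its bound
  have hFc := continuous_deriv_vacuum_rightShift β e ha hΩ heig
  obtain ⟨CF, hCF0, hCF⟩ := bounded_deriv_vacuum_rightShift β e ha hΩ heig
  -- the flow and its group property (blindness + `expPauli_smul_add`)
  set T : ℝ → GaugeConfig 3 L SU2 → GaugeConfig 3 L SU2 := fun t U => Function.update U e (U e * expPauli (t • a U)) with hT
  have hflow : ∀ s t U, T (t + s) U = T t (T s U) := by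
    intro s t U
    simp only [hT]
    rw [hblind, Function.update_idem, Function.update_self, mul_assoc, ← expPauli_smul_add, add_comm]
  have hT0 : ∀ U, T 0 U = U := fun U => by simp only [hT, zero_smul, expPauli_zero, mul_one, Function.update_eq_self]
  have hd : ∀ U, HasDerivAt (fun t => Ω (T t U)) (deriv (fun t : ℝ => Ω (Function.update U e (U e * expPauli (t • a U)))) 0) 0 :=
    fun U => (differentiableAt_vacuum_rightShift β e (a U) hΩ heig U).hasDerivAt
  have hlipΩ : ∀ U t s, |Ω (T t U) - Ω (T s U)| ≤ CF * |t - s| := fun U t s => lipschitz_of_flow T hflow Ω _ hd hCF U t s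
  -- `G = Ω²` along the flow
  have hG : Measurable fun U => Ω U * Ω U := hΩ.measurable.mul hΩ.measurable
  have hGb : ∀ U, |Ω U * Ω U| ≤ CΩ * CΩ := fun U => by
    rw [abs_mul]; exact mul_le_mul (hCΩ U) (hCΩ U) (abs_nonneg _) hCΩ0
  have hGlip : ∀ (t : ℝ) (U : GaugeConfig 3 L SU2),
      |Ω (Function.update U e (U e * expPauli (t • a U))) * Ω (Function.update U e (U e * expPauli (t • a U))) - Ω U * Ω U| ≤
        2 * CΩ * CF * |t| := by
    intro t U
    have h1 := hlipΩ U t 0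
    rw [hT0 U, sub_zero] at h1
    have hfac : Ω (T t U) * Ω (T t U) - Ω U * Ω U = (Ω (T t U) + Ω U) * (Ω (T t U) - Ω U) := by ring
    show |Ω (T t U) * Ω (T t U) - Ω U * Ω U| ≤ 2 * CΩ * CF * |t|
    rw [hfac, abs_mul]
    have h2 : |Ω (T t U) + Ω U| ≤ 2 * CΩ := (abs_add_le _ _).trans (by linarith [hCΩ (T t U), hCΩ U])
    calc |Ω (T t U) + Ω U| * |Ω (T t U) - Ω U| ≤ 2 * CΩ * (CF * |t|) :=
          mul_le_mul h2 h1 (abs_nonneg _) (by linarith)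
      _ = 2 * CΩ * CF * |t| := by ring
  have hGd : ∀ U : GaugeConfig 3 L SU2, DifferentiableAt ℝ
      (fun t : ℝ => Ω (Function.update U e (U e * expPauli (t • a U))) * Ω (Function.update U e (U e * expPauli (t • a U)))) 0 :=
    fun U => (differentiableAt_vacuum_rightShift β e (a U) hΩ heig U).mul (differentiableAt_vacuum_rightShift β e (a U) hΩ heig U)
  have hzero := integral_deriv_flow_eq_zero e ha.measurable hblind hG hGb hGlip hGd
  -- `∂_t|₀ Ω² = 2 Ω ∂Ω`
  have hderiv : ∀ U : GaugeConfig 3 L SU2,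
      deriv (fun t : ℝ => Ω (Function.update U e (U e * expPauli (t • a U))) * Ω (Function.update U e (U e * expPauli (t • a U)))) 0 =
        2 * (Ω U * deriv (fun t : ℝ => Ω (Function.update U e (U e * expPauli (t • a U)))) 0) := by
    intro U
    have h := (hd U).fun_mul (hd U)
    simp only [hT, zero_smul, expPauli_zero, mul_one, Function.update_eq_self] at h
    rw [h.deriv]; ring
  simp only [hderiv, integral_const_mul] at hzero
  linarith

/-! ## §3 The orthogonality clause of `CurrentStatePhysical` -/

/-- ★★ **`⟨XΩ, Ω⟩ = 0`** — the orthogonality clause of `CovariantCurrentDoor.CurrentStatePhysical` ⟨stmt-QuantumFields-23381⟩, with the item's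
`let`-chain verbatim. [cite: ReedSimonIV1978, Thm. XIII.43] [cite: Balaban1985UV3, p. 260] -/
theorem l2_current_vacuum_eq_zero :
    ∀ β : ℝ, 0 < β → ∀ (L : ℕ) [NeZero L], ∀ Ω : Literature.MathematicalPhysics.QuantumFieldTheory.GaugeConfig 3 L SU2 → ℝ, IsPhys Ω → l2 Ω Ω = 1 → transferApply β Ω = topValue su2Rep L β • Ω → let P : Literature.MathematicalPhysics.QuantumFieldTheory.Site 3 L → Literature.MathematicalPhysics.QuantumFieldTheory.GaugeConfig 3 L SU2 → SU2 := fun s U => polyakovSite s U ((0 : Literature.MathematicalPhysics.QuantumFieldTheory.Site 3 1), (1 : Fin 3)); let M₀ : Literature.MathematicalPhysics.QuantumFieldTheory.GaugeConfig 3 L SU2 → Literature.MathematicalPhysics.QuantumFieldTheory.Site 3 L → Matrix (Fin 2) (Fin 2) ℂ := fun U s => ((su2Rep (P s U)).trace.re : ℂ) • ((1 / 2 : ℂ) • (su2Rep (P s U) - su2Rep (P s U)⁻¹)); let T : Literature.MathematicalPhysics.QuantumFieldTheory.GaugeConfig 3 L SU2 → (Literature.MathematicalPhysics.QuantumFieldTheory.Site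 3 L → Matrix (Fin 2) (Fin 2) ℂ) → Literature.MathematicalPhysics.QuantumFieldTheory.Site 3 L → Matrix (Fin 2) (Fin 2) ℂ := fun U m s => (1 / 5 : ℂ) • (m s + ∑ i ∈ ({1, 2} : Finset (Fin 3)), (su2Rep (U (s, i)) * m (s.shift i) * su2Rep (U (s, i))⁻¹ + su2Rep (U (s - Pi.single i 1, i))⁻¹ * m (s - Pi.single i 1) * su2Rep (U (s - Pi.single i 1, i)))); let B : Literature.MathematicalPhysics.QuantumFieldTheory.GaugeConfig 3 L SU2 → Literature.MathematicalPhysics.QuantumFieldTheory.Site 3 L → Matrix (Fin 2) (Fin 2) ℂ := fun U => (T U)^[L ^ 2 * (⌈Real.log β⌉₊ + 1)] (M₀ U); let b : Literature.MathematicalPhysics.QuantumFieldTheory.Site 3 L → Literature.MathematicalPhysics.QuantumFieldTheory.GaugeConfig 3 L SU2 → EuclideanSpace ℝ (Fin 3) := fun s U => (EuclideanSpace.equiv (Fin 3) ℝ).symm fun a => (-(Complex.I / 2) * (Literature.MathematicalPhysics.QuantumFieldTheory.Balaban1983to89.B10Eq18SigmaSU2.pauli a * B U s).trace).re; let X : (Literature.MathematicalPhysics.QuantumFieldTheory.GaugeConfig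 3 L SU2 → ℝ) → Literature.MathematicalPhysics.QuantumFieldTheory.GaugeConfig 3 L SU2 → ℝ := fun ψ U => ∑ x : Literature.MathematicalPhysics.QuantumFieldTheory.Site 3 L, deriv (fun t : ℝ => ψ (Function.update U (x, (0 : Fin 3)) (U (x, (0 : Fin 3)) * Literature.MathematicalPhysics.QuantumFieldTheory.Balaban1983to89.B10Eq18SigmaSU2Haar.expPauli (t • b (x.shift 0) U)))) 0; l2 (X Ω) Ω = 0 := by
  intro β _hβ L _ Ω hΩ _hn heig
  dsimp only
  haveI : SecondCountableTopology SU2 := secondCountableTopology_su2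
  -- continuity and blindness of the direction field at each base site
  have hB := continuous_smoothedField (L := L) (L ^ 2 * (⌈Real.log β⌉₊ + 1))
  have hdir : ∀ x : Site 3 L, Continuous fun U : GaugeConfig 3 L SU2 => ((EuclideanSpace.equiv (Fin 3) ℝ).symm fun a => (-(Complex.I / 2) * (pauli a *
        ((fun m : Site 3 L → Matrix (Fin 2) (Fin 2) ℂ => fun s : Site 3 L =>
          (1 / 5 : ℂ) • (m s + ∑ i ∈ ({1, 2} : Finset (Fin 3)),
            (su2Rep (U (s, i)) * m (s.shift i) * su2Rep (U (s, i))⁻¹ +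
              su2Rep (U (s - Pi.single i 1, i))⁻¹ * m (s - Pi.single i 1) * su2Rep (U (s - Pi.single i 1, i)))))^[L ^ 2 * (⌈Real.log β⌉₊ + 1)]
        (fun s : Site 3 L =>
          ((su2Rep (polyakovSite s U ((0 : Site 3 1), (1 : Fin 3)))).trace.re : ℂ) •
            ((1 / 2 : ℂ) • (su2Rep (polyakovSite s U ((0 : Site 3 1), (1 : Fin 3))) -
              su2Rep (polyakovSite s U ((0 : Site 3 1), (1 : Fin 3)))⁻¹))) (x.shift 0))).trace).re) :=
    fun x => continuous_colourOf ((continuous_apply (x.shift 0)).comp hB)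
  have hblind : ∀ (x : Site 3 L) (U : GaugeConfig 3 L SU2) (y : SU2),
      ((EuclideanSpace.equiv (Fin 3) ℝ).symm fun a => (-(Complex.I / 2) * (pauli a *
        ((fun m : Site 3 L → Matrix (Fin 2) (Fin 2) ℂ => fun s : Site 3 L =>
          (1 / 5 : ℂ) • (m s + ∑ i ∈ ({1, 2} : Finset (Fin 3)),
            (su2Rep ((Function.update U (x, (0 : Fin 3)) y) (s, i)) * m (s.shift i) * su2Rep ((Function.update U (x, (0 : Fin 3)) y) (s, i))⁻¹ +
              su2Rep ((Function.update U (x, (0 : Fin 3)) y) (s - Pi.single i 1, i))⁻¹ * m (s - Pi.single i 1) * su2Rep ((Function.update U (x, (0 : Fin 3)) y) (s - Pi.single i 1, i)))))^[L ^ 2 * (⌈Real.log β⌉₊ + 1)]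
        (fun s : Site 3 L =>
          ((su2Rep (polyakovSite s (Function.update U (x, (0 : Fin 3)) y) ((0 : Site 3 1), (1 : Fin 3)))).trace.re : ℂ) •
            ((1 / 2 : ℂ) • (su2Rep (polyakovSite s (Function.update U (x, (0 : Fin 3)) y) ((0 : Site 3 1), (1 : Fin 3))) -
              su2Rep (polyakovSite s (Function.update U (x, (0 : Fin 3)) y) ((0 : Site 3 1), (1 : Fin 3)))⁻¹))) (x.shift 0))).trace).re) = ((EuclideanSpace.equiv (Fin 3) ℝ).symm fun a => (-(Complex.I / 2) * (pauli a *
        ((fun m : Site 3 L → Matrix (Fin 2) (Fin 2) ℂ => fun s : Site 3 L =>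
          (1 / 5 : ℂ) • (m s + ∑ i ∈ ({1, 2} : Finset (Fin 3)),
            (su2Rep (U (s, i)) * m (s.shift i) * su2Rep (U (s, i))⁻¹ +
              su2Rep (U (s - Pi.single i 1, i))⁻¹ * m (s - Pi.single i 1) * su2Rep (U (s - Pi.single i 1, i)))))^[L ^ 2 * (⌈Real.log β⌉₊ + 1)]
        (fun s : Site 3 L =>
          ((su2Rep (polyakovSite s U ((0 : Site 3 1), (1 : Fin 3)))).trace.re : ℂ) •
            ((1 / 2 : ℂ) • (su2Rep (polyakovSite s U ((0 : Site 3 1), (1 : Fin 3))) -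
              su2Rep (polyakovSite s U ((0 : Site 3 1), (1 : Fin 3)))⁻¹))) (x.shift 0))).trace).re) := by
    intro x U y
    rw [smoothedField_update_dir0]
  -- each base site contributes zero
  have hx : ∀ x : Site 3 L, ∫ U, Ω U * deriv (fun t : ℝ => Ω (Function.update U (x, (0 : Fin 3)) (U (x, (0 : Fin 3)) *
      expPauli (t • ((EuclideanSpace.equiv (Fin 3) ℝ).symm fun a => (-(Complex.I / 2) * (pauli a *
        ((fun m : Site 3 L → Matrix (Fin 2) (Fin 2) ℂ => fun s : Site 3 L =>
          (1 / 5 : ℂ) • (m s + ∑ i ∈ ({1, 2} : Finset (Fin 3)),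
            (su2Rep (U (s, i)) * m (s.shift i) * su2Rep (U (s, i))⁻¹ +
              su2Rep (U (s - Pi.single i 1, i))⁻¹ * m (s - Pi.single i 1) * su2Rep (U (s - Pi.single i 1, i)))))^[L ^ 2 * (⌈Real.log β⌉₊ + 1)]
        (fun s : Site 3 L =>
          ((su2Rep (polyakovSite s U ((0 : Site 3 1), (1 : Fin 3)))).trace.re : ℂ) •
            ((1 / 2 : ℂ) • (su2Rep (polyakovSite s U ((0 : Site 3 1), (1 : Fin 3))) -
              su2Rep (polyakovSite s U ((0 : Site 3 1), (1 : Fin 3)))⁻¹))) (x.shift 0))).trace).re))))) 0 ∂configMeasure SU2 L = 0 :=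
    fun x => integral_vacuum_mul_deriv_eq_zero β (x, (0 : Fin 3)) (hdir x) (hblind x) hΩ heig
  -- integrability of each term and the sum
  obtain ⟨CΩ, hCΩ⟩ := hΩ.bounded
  have hint : ∀ x : Site 3 L, Integrable (fun U => deriv (fun t : ℝ => Ω (Function.update U (x, (0 : Fin 3)) (U (x, (0 : Fin 3)) *
      expPauli (t • ((EuclideanSpace.equiv (Fin 3) ℝ).symm fun a => (-(Complex.I / 2) * (pauli a *
        ((fun m : Site 3 L → Matrix (Fin 2) (Fin 2) ℂ => fun s : Site 3 L =>
          (1 / 5 : ℂ) • (m s + ∑ i ∈ ({1, 2} : Finset (Fin 3)),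
            (su2Rep (U (s, i)) * m (s.shift i) * su2Rep (U (s, i))⁻¹ +
              su2Rep (U (s - Pi.single i 1, i))⁻¹ * m (s - Pi.single i 1) * su2Rep (U (s - Pi.single i 1, i)))))^[L ^ 2 * (⌈Real.log β⌉₊ + 1)]
        (fun s : Site 3 L =>
          ((su2Rep (polyakovSite s U ((0 : Site 3 1), (1 : Fin 3)))).trace.re : ℂ) •
            ((1 / 2 : ℂ) • (su2Rep (polyakovSite s U ((0 : Site 3 1), (1 : Fin 3))) -
              su2Rep (polyakovSite s U ((0 : Site 3 1), (1 : Fin 3)))⁻¹))) (x.shift 0))).trace).re))))) 0 * Ω U) (configMeasure SU2 L) := by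
    intro x
    haveI : IsProbabilityMeasure (configMeasure SU2 L) := by unfold configMeasure; infer_instance
    obtain ⟨CF, hCF0, hCF⟩ := bounded_deriv_vacuum_rightShift β (x, (0 : Fin 3)) (hdir x) hΩ heig
    refine Integrable.of_bound ((measurable_deriv_vacuum_rightShift β (x, (0 : Fin 3)) (hdir x) hΩ heig).mul
      hΩ.measurable).aestronglyMeasurable (CF * CΩ) (ae_of_all _ fun U => ?_)
    rw [Real.norm_eq_abs, abs_mul]
    exact mul_le_mul (hCF U) (hCΩ U) (abs_nonneg _) hCF0
  unfold l2
  rw [show (fun U : GaugeConfig 3 L SU2 => (∑ x : Site 3 L, deriv (fun t : ℝ => Ω (Function.update U (x, (0 : Fin 3)) (U (x, (0 : Fin 3)) *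
      expPauli (t • ((EuclideanSpace.equiv (Fin 3) ℝ).symm fun a => (-(Complex.I / 2) * (pauli a *
        ((fun m : Site 3 L → Matrix (Fin 2) (Fin 2) ℂ => fun s : Site 3 L =>
          (1 / 5 : ℂ) • (m s + ∑ i ∈ ({1, 2} : Finset (Fin 3)),
            (su2Rep (U (s, i)) * m (s.shift i) * su2Rep (U (s, i))⁻¹ +
              su2Rep (U (s - Pi.single i 1, i))⁻¹ * m (s - Pi.single i 1) * su2Rep (U (s - Pi.single i 1, i)))))^[L ^ 2 * (⌈Real.log β⌉₊ + 1)]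
        (fun s : Site 3 L =>
          ((su2Rep (polyakovSite s U ((0 : Site 3 1), (1 : Fin 3)))).trace.re : ℂ) •
            ((1 / 2 : ℂ) • (su2Rep (polyakovSite s U ((0 : Site 3 1), (1 : Fin 3))) -
              su2Rep (polyakovSite s U ((0 : Site 3 1), (1 : Fin 3)))⁻¹))) (x.shift 0))).trace).re))))) 0) * Ω U) =
      fun U => ∑ x : Site 3 L, deriv (fun t : ℝ => Ω (Function.update U (x, (0 : Fin 3)) (U (x, (0 : Fin 3)) *
      expPauli (t • ((EuclideanSpace.equiv (Fin 3) ℝ).symm fun a => (-(Complex.I / 2) * (pauli a *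
        ((fun m : Site 3 L → Matrix (Fin 2) (Fin 2) ℂ => fun s : Site 3 L =>
          (1 / 5 : ℂ) • (m s + ∑ i ∈ ({1, 2} : Finset (Fin 3)),
            (su2Rep (U (s, i)) * m (s.shift i) * su2Rep (U (s, i))⁻¹ +
              su2Rep (U (s - Pi.single i 1, i))⁻¹ * m (s - Pi.single i 1) * su2Rep (U (s - Pi.single i 1, i)))))^[L ^ 2 * (⌈Real.log β⌉₊ + 1)]
        (fun s : Site 3 L =>
          ((su2Rep (polyakovSite s U ((0 : Site 3 1), (1 : Fin 3)))).trace.re : ℂ) •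
            ((1 / 2 : ℂ) • (su2Rep (polyakovSite s U ((0 : Site 3 1), (1 : Fin 3))) -
              su2Rep (polyakovSite s U ((0 : Site 3 1), (1 : Fin 3)))⁻¹))) (x.shift 0))).trace).re))))) 0 * Ω U from funext fun U => Finset.sum_mul _ _ _]
  rw [integral_finsetSum _ fun x _ => hint x]
  refine Finset.sum_eq_zero fun x _ => ?_
  refine Eq.trans (integral_congr_ae (ae_of_all _ fun U => ?_)) (hx x)
  dsimp only
  exact mul_comm _ _

end Summit.QuantumFields.YangMills.Theorems.CovariantCurrentDoor

end
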